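import Summits.AtomisticToContinuum.FouriersLaw.Theorems.BondHeatUncertaintyExtensiveSnapshotIrreversibilityEnergyWindowExcessSeam
import Literature.Analysis.Calculus.ContinuousMollifierApprox

/-!
# Crux `ExtensiveSnapshotIrreversibility` (stmt-AtomisticToContinuum-9121), fixed-`N` half `K_fix`:
the LOWER half of the sharp triangular asymptotics is a THEOREM of the item's own hypothesis
(node «UniformIntegrabilityLadder», 4/4 of the seam files)

(helper file, theorem-side; decomp-a2c lens-1 «grading / quantitative ladder», generation 90.)

`K_fix` is stated at an `L²` linear-response density `h` of the steady states at `δ = 0`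
(difference quotients of `∫ F dμ_δ` converge to `∫ F h dμ_{N,T,T}` for every test function
`F ∈ C_c^∞`).  Generation 89 isolated the UPPER half `Δ(μ_δ, Θ_*μ_δ) ≤ K δ²` (`K > K₀`,
`K₀ = ½ ∫ (h − h∘Θ)² dμ_{N,T,T}`) of the sharp second-order asymptotics of the triangular
discrimination as the atom ΔSharp.  This file PROVES the LOWER half from the hypothesis alone:

* ★ `nessFlipTriangularLower_holds : NessFlipTriangularLower` — for every `K < K₀`, eventually in
  `δ ≠ 0`, for every measurable `φ` with `μ_δ = μ_T · e^{φ}`: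
  `K δ² ≤ ∫ (e^{φ} − e^{φ∘Θ})²/(e^{φ} + e^{φ∘Θ}) dμ_T`.

Mechanism (duality, no regularity of `φ`): the triangular discrimination is a supremum of
expressions that are LINEAR in the pair of measures,
`Δ ≥ 2c (∫ G dμ_δ − ∫ G∘Θ dμ_δ) − c² (∫ G² dμ_δ + ∫ (G∘Θ)² dμ_δ)` for every bounded test function
`G` and every real `c` (`two_mul_integral_sub_le_integral_triangular`, completing a square);
with `c = δ s` the right-hand side is `δ² (2 s a_δ/δ − s² b_δ)` where, BY THE RESPONSE HYPOTHESIS,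
`a_δ/δ → A = ∫ G (h − h∘Θ) dμ_T` and `b_δ → B = 2 ∫ G² dμ_T`; the choice `s = K/A` gives the
coefficient `2K − K² B/A² > K` as soon as `A² > K B`; such a `G ∈ C_c^∞` exists for every
`K < K₀` (`exists_testFunction_coef_gt`) by DENSITY of test functions in `L²(μ_T)`
(`exists_smooth_integral_sub_sq_le`: Mathlib regularity + uniform smoothing
`Literature.Analysis.Calculus.exists_contDiff_approx_of_continuous` + a bump cutoff) and
polarisation, `A² − K B = (A − 2K)² + 2K (∫ k² − 2K − ∫ (G − k)²) > 0`.
Consequence (`…EnergyWindowExcessAtoms`): with `KL ≤ K δ²` from `K_fix` and `Δ ≥ K' δ²` from here,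
the EXCESS `KL − Δ = o(δ²)`, two-sidedly equivalent to uniform integrability of the odd log-ratio
at scale `δ²` — so that atom is NECESSARY for `K_fix`.  No new objects. [folklore]
-/

noncomputable section

namespace Summit.AtomisticToContinuum.FouriersLaw.Theorems.ExtensiveSnapshotIrreversibility.EnergyWindow

open MeasureTheory Filter Topology InformationTheory Real
open scoped ENNReal NNReal
open Literature.MathematicalPhysics.KineticTheory.HeatConduction
open Summit.AtomisticToContinuum.FouriersLaw.Theorems.ExtensiveSnapshotIrreversibility.Negative
open Summit.AtomisticToContinuum.FouriersLaw.Theorems.ExtensiveSnapshotIrreversibility.ClausiusBudget.OddLogDensity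

variable {N : ℕ}

/-! ## 1. Density of test functions in `L²` of a finite measure on phase space -/

/-- **Test functions are dense in `L²(μ₀)`** for a finite Borel measure `μ₀` on phase space: for
`k ∈ L²(μ₀)` and `ε > 0` there is `G ∈ C_c^∞` with `∫ (G − k)² dμ₀ ≤ ε` (continuous compactly
supported `g` with `∫ (g − k)² ≤ ε/4` by regularity, Mathlib; a `C^∞` map `u` uniformly
`η`-close to `g` on a ball containing the support, by mollification; `G = χ u` for a bump `χ`
equal to `1` on the support of `g`, so that `|G − g| ≤ η` everywhere). [folklore] -/
theorem exists_smooth_integral_sub_sq_le (μ₀ : Measure (PhaseSpace N)) [IsFiniteMeasure μ₀]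
    {k : PhaseSpace N → ℝ} (hk : MemLp k 2 μ₀) {ε : ℝ} (hε : 0 < ε) :
    ∃ G : PhaseSpace N → ℝ, ContDiff ℝ ((⊤ : ℕ∞) : WithTop ℕ∞) G ∧ HasCompactSupport G ∧
      Continuous G ∧ ∫ x, (G x - k x) ^ 2 ∂μ₀ ≤ ε := by
  have hk' : MemLp k (ENNReal.ofReal 2) μ₀ := by rwa [ENNReal.ofReal_ofNat]
  obtain ⟨g, hgc, hgε, hgcont, hgL2⟩ :=
    hk'.exists_hasCompactSupport_integral_rpow_sub_le two_pos (ε := ε / 4) (by positivity)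
  rw [ENNReal.ofReal_ofNat] at hgL2
  have hgε' : ∫ x, (g x - k x) ^ 2 ∂μ₀ ≤ ε / 4 := by
    refine le_trans (le_of_eq (integral_congr_ae (ae_of_all _ fun x => ?_))) hgε
    simp only
    rw [Real.rpow_two, Real.norm_eq_abs, sq_abs]
    ring
  -- the support of `g` in a ball, a uniform smoothing on a bigger ball, a bump cutoff
  obtain ⟨R₀, hR₀⟩ := hgc.isCompact.isBounded.subset_closedBall (0 : PhaseSpace N)
  set R : ℝ := max R₀ 0 with hR
  have hRg : tsupport g ⊆ Metric.closedBall (0 : PhaseSpace N) R :=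
    hR₀.trans (Metric.closedBall_subset_closedBall (le_max_left _ _))
  have hR0 : 0 ≤ R := le_max_right _ _
  set m : ℝ := (μ₀ Set.univ).toReal with hm
  have hm0 : 0 ≤ m := ENNReal.toReal_nonneg
  set η : ℝ := min 1 (ε / (4 * (m + 1))) with hη
  have hη0 : 0 < η := lt_min one_pos (by positivity)
  have hη1 : η ≤ 1 := min_le_left _ _
  have hηε : η ≤ ε / (4 * (m + 1)) := min_le_right _ _
  obtain ⟨u, hu, -, huη⟩ := Literature.Analysis.Calculus.exists_contDiff_approx_of_continuous
    hgcont (isCompact_closedBall (0 : PhaseSpace N) (R + 2)) hη0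
  let χ : ContDiffBump (0 : PhaseSpace N) := ⟨R + 1, R + 2, by linarith, by linarith⟩
  have hχs : ContDiff ℝ ((⊤ : ℕ∞) : WithTop ℕ∞) (χ : PhaseSpace N → ℝ) := χ.contDiff (n := ⊤)
  -- `|χ u − g| ≤ η` everywhere
  have hclose : ∀ x, |χ x * u x - g x| ≤ η := by
    intro x
    by_cases hx : dist x 0 ≤ R + 2
    · have hux : |u x - g x| ≤ η := by
        have := huη x (Metric.mem_closedBall.2 hx)
        rwa [Real.norm_eq_abs] at this
      by_cases hx1 : dist x 0 ≤ R + 1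
      · rw [χ.one_of_mem_closedBall (Metric.mem_closedBall.2 hx1), one_mul]
        exact hux
      · have hgx : g x = 0 := by
          by_contra hne
          have hxs : x ∈ tsupport g := subset_tsupport g (Function.mem_support.2 hne)
          have := Metric.mem_closedBall.1 (hRg hxs)
          exact hx1 (by linarith)
        rw [hgx] at hux ⊢
        rw [sub_zero, abs_mul, abs_of_nonneg χ.nonneg]
        rw [sub_zero] at hux
        exact (mul_le_of_le_one_left (abs_nonneg _) χ.le_one).trans hux
    · have hx' : R + 2 < dist x 0 := lt_of_not_ge hx
      have hgx : g x = 0 := by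
        by_contra hne
        have hxs : x ∈ tsupport g := subset_tsupport g (Function.mem_support.2 hne)
        have := Metric.mem_closedBall.1 (hRg hxs)
        linarith
      rw [χ.zero_of_le_dist hx'.le, hgx]
      simpa using hη0.le
  have hGcont : Continuous fun x => χ x * u x := χ.continuous.mul hu.continuous
  have hGc : HasCompactSupport fun x => χ x * u x := χ.hasCompactSupport.mul_right
  refine ⟨fun x => χ x * u x, hχs.mul hu, hGc, hGcont, ?_⟩
  -- `∫ (G − k)² ≤ 2 ∫ (G − g)² + 2 ∫ (g − k)² ≤ 2 η² m + ε/2 ≤ ε`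
  have hGL2 : MemLp (fun x => χ x * u x) 2 μ₀ := hGcont.memLp_of_hasCompactSupport hGc
  have hi1 : Integrable (fun x => (χ x * u x - g x) ^ 2) μ₀ := (hGL2.sub hgL2).integrable_sq
  have hi2 : Integrable (fun x => (g x - k x) ^ 2) μ₀ := (hgL2.sub hk).integrable_sq
  have hi3 : Integrable (fun x => (χ x * u x - k x) ^ 2) μ₀ := (hGL2.sub hk).integrable_sq
  have hb1 : ∫ x, (χ x * u x - g x) ^ 2 ∂μ₀ ≤ η ^ 2 * m := by
    have h := integral_mono hi1 (integrable_const (η ^ 2)) fun x => by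
      have hx := hclose x
      have : (χ x * u x - g x) ^ 2 = |χ x * u x - g x| ^ 2 := (sq_abs _).symm
      rw [this]
      exact pow_le_pow_left₀ (abs_nonneg _) hx 2
    rw [integral_const, smul_eq_mul] at h
    rw [hm, measureReal_def] at *
    linarith [h]
  have hη2 : η ^ 2 * m ≤ ε / 4 := by
    have h1 : η ^ 2 ≤ η := by nlinarith
    have h2 : η * m ≤ ε / (4 * (m + 1)) * m := mul_le_mul_of_nonneg_right hηε hm0
    have h3 : ε / (4 * (m + 1)) * m ≤ ε / 4 := by
      rw [div_mul_eq_mul_div, div_le_div_iff₀ (by positivity) (by positivity)]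
      nlinarith
    nlinarith
  calc ∫ x, (χ x * u x - k x) ^ 2 ∂μ₀
      ≤ ∫ x, (2 * (χ x * u x - g x) ^ 2 + 2 * (g x - k x) ^ 2) ∂μ₀ :=
        integral_mono hi3 ((hi1.const_mul 2).add (hi2.const_mul 2)) fun x => by
          nlinarith [sq_nonneg (χ x * u x - g x - (g x - k x))]
    _ = 2 * ∫ x, (χ x * u x - g x) ^ 2 ∂μ₀ + 2 * ∫ x, (g x - k x) ^ 2 ∂μ₀ := by
        rw [integral_add (hi1.const_mul 2) (hi2.const_mul 2), integral_const_mul,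
          integral_const_mul]
    _ ≤ ε := by linarith

/-! ## 2. Duality: a linear lower bound for the triangular discrimination -/

section Duality

variable (μ₀ : Measure (PhaseSpace N))

/-- ★ **Duality lower bound for the triangular discrimination of a flipped tilt.**  For a
normalised tilt `μ₀ · e^{φ}` of a flip-invariant measure `μ₀`, a bounded continuous test
function `G` and a real `c`:
`2c (∫ G d(μ₀·e^{φ}) − ∫ G∘Θ d(μ₀·e^{φ})) − c² (∫ G² d(μ₀·e^{φ}) + ∫ (G∘Θ)² d(μ₀·e^{φ}))`
`≤ ∫ (e^{φ} − e^{φ∘Θ})²/(e^{φ} + e^{φ∘Θ}) dμ₀` (integrate `two_mul_sub_sq_mul_le_triangular` against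
`μ₀` and move the flip from `e^{φ}` to `G` by invariance).  No regularity of `φ`. [folklore] -/
theorem two_mul_integral_sub_le_integral_triangular
    (hinv : μ₀.map (fun x : PhaseSpace N => (x.1, -x.2)) = μ₀) {φ : PhaseSpace N → ℝ}
    (hφm : Measurable φ) (hexp : Integrable (fun x => exp (φ x)) μ₀)
    (hZ1 : ∫ x, exp (φ x) ∂μ₀ = 1) {G : PhaseSpace N → ℝ} (hGc : Continuous G) {M : ℝ}
    (hM : ∀ x, ‖G x‖ ≤ M) (c : ℝ) :
    2 * c * (∫ x, G x ∂μ₀.tilted φ - ∫ x, G (x.1, -x.2) ∂μ₀.tilted φ) -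
        c ^ 2 * (∫ x, G x ^ 2 ∂μ₀.tilted φ + ∫ x, G (x.1, -x.2) ^ 2 ∂μ₀.tilted φ) ≤
      ∫ x, (exp (φ x) - exp (φ (x.1, -x.2))) ^ 2 / (exp (φ x) + exp (φ (x.1, -x.2))) ∂μ₀ := by
  have hexp' : Integrable (fun x => exp (φ (x.1, -x.2))) μ₀ :=
    (integrable_comp_flip_iff μ₀ hinv (fun x => exp (φ x))).2 hexp
  have hGm : AEStronglyMeasurable G μ₀ := hGc.aestronglyMeasurable
  have hG2m : AEStronglyMeasurable (fun x => G x ^ 2) μ₀ := (hGc.pow 2).aestronglyMeasurable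
  have hM2 : ∀ x, ‖G x ^ 2‖ ≤ M ^ 2 := fun x => by
    rw [norm_pow]
    exact pow_le_pow_left₀ (norm_nonneg _) (hM x) 2
  -- the four integrable pieces against `μ₀`
  have i1 : Integrable (fun x => G x * exp (φ x)) μ₀ := hexp.bdd_mul hGm (ae_of_all _ hM)
  have i2 : Integrable (fun x => G x * exp (φ (x.1, -x.2))) μ₀ := hexp'.bdd_mul hGm (ae_of_all _ hM)
  have i3 : Integrable (fun x => G x ^ 2 * exp (φ x)) μ₀ := hexp.bdd_mul hG2m (ae_of_all _ hM2)
  have i4 : Integrable (fun x => G x ^ 2 * exp (φ (x.1, -x.2))) μ₀ :=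
    hexp'.bdd_mul hG2m (ae_of_all _ hM2)
  -- tilted integrals as `μ₀`-integrals; the flip moved onto `G`
  have ht : ∀ u : PhaseSpace N → ℝ, ∫ x, u x ∂μ₀.tilted φ = ∫ x, u x * exp (φ x) ∂μ₀ := by
    intro u
    rw [integral_tilted]
    refine integral_congr_ae (ae_of_all _ fun x => ?_)
    simp only [hZ1, div_one, smul_eq_mul]
    ring
  have hf1 : ∫ x, G (x.1, -x.2) * exp (φ x) ∂μ₀ = ∫ x, G x * exp (φ (x.1, -x.2)) ∂μ₀ := by
    have e := integral_comp_flip μ₀ hinv (fun y => G y * exp (φ (y.1, -y.2)))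
    simp only [neg_neg, Prod.mk.eta] at e
    exact e
  have hf2 : ∫ x, G (x.1, -x.2) ^ 2 * exp (φ x) ∂μ₀ = ∫ x, G x ^ 2 * exp (φ (x.1, -x.2)) ∂μ₀ := by
    have e := integral_comp_flip μ₀ hinv (fun y => G y ^ 2 * exp (φ (y.1, -y.2)))
    simp only [neg_neg, Prod.mk.eta] at e
    exact e
  rw [ht G, ht (fun x => G (x.1, -x.2)), ht (fun x => G x ^ 2), ht (fun x => G (x.1, -x.2) ^ 2),
    hf1, hf2]
  -- integrate the pointwise inequality
  have i12 : Integrable (fun x => 2 * c * (G x * exp (φ x)) -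
      2 * c * (G x * exp (φ (x.1, -x.2)))) μ₀ := (i1.const_mul _).sub (i2.const_mul _)
  have i34 : Integrable (fun x => c ^ 2 * (G x ^ 2 * exp (φ x)) +
      c ^ 2 * (G x ^ 2 * exp (φ (x.1, -x.2)))) μ₀ := (i3.const_mul _).add (i4.const_mul _)
  have hmono : ∫ x, (2 * c * (G x * exp (φ x)) - 2 * c * (G x * exp (φ (x.1, -x.2))) -
      (c ^ 2 * (G x ^ 2 * exp (φ x)) + c ^ 2 * (G x ^ 2 * exp (φ (x.1, -x.2))))) ∂μ₀ ≤
      ∫ x, (exp (φ x) - exp (φ (x.1, -x.2))) ^ 2 / (exp (φ x) + exp (φ (x.1, -x.2))) ∂μ₀ :=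
    integral_mono (i12.sub i34) (integrable_triangular μ₀ hinv hφm hexp) fun x => by
      have h := two_mul_sub_sq_mul_le_triangular (φ x) (φ (x.1, -x.2)) c (G x)
      simp only
      linarith [h]
  rw [integral_sub i12 i34, integral_sub (i1.const_mul _) (i2.const_mul _),
    integral_add (i3.const_mul _) (i4.const_mul _), integral_const_mul, integral_const_mul,
    integral_const_mul, integral_const_mul] at hmono
  linarith [hmono]

end Duality

/-! ## 3. The NESS lower half `ΔLower` -/

/-- **A test function with a good duality coefficient.**  For `k ∈ L²(μ₀)` (finite measure) and
`0 < K` with `2K < ∫ k² dμ₀ =: κ`: there are a test function `G` (smooth, compactly supported,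
bounded by `M`) and a slope `s` with `K < 2 s A − s² · 2B₀`, `A = ∫ G k dμ₀`, `B₀ = ∫ G² dμ₀`.
Density (`exists_smooth_integral_sub_sq_le` with `∫ (G − k)² ≤ (κ − 2K)/2`) and polarisation
`∫ (G − k)² = B₀ − 2A + κ` give `A > 0` and `A² > 2K B₀`; then `s = K/A` has coefficient
`2K − 2K² B₀/A² > K`. [folklore] -/
theorem exists_testFunction_coef_gt (μ₀ : Measure (PhaseSpace N)) [IsFiniteMeasure μ₀]
    {k : PhaseSpace N → ℝ} (hk : MemLp k 2 μ₀) {K : ℝ} (hK0 : 0 < K)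
    (hK : 2 * K < ∫ x, k x ^ 2 ∂μ₀) :
    ∃ G : PhaseSpace N → ℝ, ∃ s M : ℝ, ContDiff ℝ ((⊤ : ℕ∞) : WithTop ℕ∞) G ∧
      HasCompactSupport G ∧ Continuous G ∧ (∀ x, ‖G x‖ ≤ M) ∧
      K < 2 * s * (∫ x, G x * k x ∂μ₀) - s ^ 2 * (2 * ∫ x, G x ^ 2 ∂μ₀) := by
  set κ : ℝ := ∫ x, k x ^ 2 ∂μ₀ with hκ
  -- a test function `G` with `∫ (G − k)² ≤ (κ − 2K)/2`
  obtain ⟨G, hGs, hGc, hGcont, hGd⟩ :=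
    exists_smooth_integral_sub_sq_le μ₀ hk (ε := (κ - 2 * K) / 2) (by linarith)
  obtain ⟨M, hM⟩ := hGcont.bounded_above_of_compact_support hGc
  have hGL2 : MemLp G 2 μ₀ := hGcont.memLp_of_hasCompactSupport hGc
  have iGk : Integrable (fun x => G x * k x) μ₀ :=
    (hk.integrable one_le_two).bdd_mul hGcont.aestronglyMeasurable (ae_of_all _ hM)
  have iG2 : Integrable (fun x => G x ^ 2) μ₀ := hGL2.integrable_sq
  have ik2 : Integrable (fun x => k x ^ 2) μ₀ := hk.integrable_sq
  set A : ℝ := ∫ x, G x * k x ∂μ₀ with hA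
  set B₀ : ℝ := ∫ x, G x ^ 2 ∂μ₀ with hB₀
  have hB₀0 : 0 ≤ B₀ := integral_nonneg fun x => sq_nonneg _
  -- polarisation: `∫ (G − k)² = B₀ − 2A + κ`, hence `A > 0` and `A² > 2K B₀`
  have hpol : ∫ x, (G x - k x) ^ 2 ∂μ₀ = B₀ - 2 * A + κ := by
    have e : ∀ x, (G x - k x) ^ 2 = G x ^ 2 - 2 * (G x * k x) + k x ^ 2 := fun x => by ring
    have i12 : Integrable (fun x => G x ^ 2 - 2 * (G x * k x)) μ₀ := iG2.sub (iGk.const_mul 2)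
    simp_rw [e]
    rw [integral_add i12 ik2, integral_sub iG2 (iGk.const_mul 2), integral_const_mul]
  have hd : B₀ - 2 * A + κ ≤ (κ - 2 * K) / 2 := hpol ▸ hGd
  have hApos : 0 < A := by nlinarith
  have hkey : 2 * K * B₀ < A ^ 2 := by nlinarith [sq_nonneg (A - 2 * K)]
  -- the slope `s = K/A`; the coefficient `2K − K² (2B₀)/A² > K`
  refine ⟨G, K / A, M, hGs, hGc, hGcont, hM, ?_⟩
  have e : 2 * (K / A) * A - (K / A) ^ 2 * (2 * B₀) = 2 * K - K ^ 2 * (2 * B₀) / A ^ 2 := by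
    field_simp
  rw [e]
  have h1 : K ^ 2 * (2 * B₀) / A ^ 2 < K := by
    rw [div_lt_iff₀ (by positivity)]
    nlinarith
  linarith

/-- **ΔLower `NessFlipTriangularLower` (the lower half of the sharp second-order snapshot
irreversibility in triangular discrimination)**: along every steady-state family of the pinned
chain (under weak-NESS uniqueness), for `T > 0`, `N ≥ 2`, every `L²` linear-response density `h`
at `δ = 0` (VERBATIM the hypothesis of `K_fix`) and every `K < ½ ∫ (h − h∘Θ)² dμ_{N,T,T}`:
eventually in `δ ≠ 0`, for EVERY measurable `φ` with `μ_{N,T+δ/2,T−δ/2} = μ_T · e^{φ}`,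
`K δ² ≤ ∫ (e^{φ} − e^{φ∘Θ})²/(e^{φ} + e^{φ∘Θ}) dμ_T`.  A THEOREM (`nessFlipTriangularLower_holds`);
the matching upper half is the atom ΔSharp `NessFlipTriangularSharp`.
[route statement · this cell; PROVED below] -/
def NessFlipTriangularLower : Prop :=
  ∀ ω₂ lam β γ : ℝ, 0 < ω₂ → 0 < lam → 0 < β → 0 < γ →
    (∀ (N : ℕ) (T_L T_R : ℝ), 0 < T_L → 0 < T_R → ∀ μ ν : Measure (PhaseSpace N),
      (pinnedChain ω₂ lam β γ).IsSteadyState N T_L T_R μ →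
      (pinnedChain ω₂ lam β γ).IsSteadyState N T_L T_R ν → μ = ν) →
    ∀ μ : (N : ℕ) → ℝ → ℝ → Measure (PhaseSpace N),
      (∀ (N : ℕ) (T_L T_R : ℝ), 0 < T_L → 0 < T_R →
        (pinnedChain ω₂ lam β γ).IsSteadyState N T_L T_R (μ N T_L T_R)) →
      ∀ T : ℝ, 0 < T → ∀ N : ℕ, 2 ≤ N → ∀ h : PhaseSpace N → ℝ,
        (MemLp h 2 (μ N T T) ∧
          (∀ F : PhaseSpace N → ℝ, ContDiff ℝ ((⊤ : ℕ∞) : WithTop ℕ∞) F → HasCompactSupport F →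
            Tendsto (fun δ : ℝ => ((∫ x, F x ∂(μ N (T + δ / 2) (T - δ / 2))) -
              ∫ x, F x ∂(μ N T T)) / δ)
              (𝓝[≠] (0 : ℝ)) (𝓝 (∫ x, F x * h x ∂(μ N T T)))) ∧
          (∀ i : Fin N, Tendsto (fun δ : ℝ =>
              ((∫ x, (pinnedChain ω₂ lam β γ).bondCurrent N i x ∂(μ N (T + δ / 2) (T - δ / 2))) -
                ∫ x, (pinnedChain ω₂ lam β γ).bondCurrent N i x ∂(μ N T T)) / δ)
              (𝓝[≠] (0 : ℝ))
              (𝓝 (∫ x, (pinnedChain ω₂ lam β γ).bondCurrent N i x * h x ∂(μ N T T))))) →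
        ∀ K : ℝ, K < (1 / 2 : ℝ) * ∫ x, (h x - h (x.1, -x.2)) ^ 2 ∂(μ N T T) →
          ∀ᶠ δ in 𝓝[≠] (0 : ℝ),
            ∀ φ : PhaseSpace N → ℝ, Measurable φ →
              μ N (T + δ / 2) (T - δ / 2) =
                ((pinnedChain ω₂ lam β γ).gibbsMeasure N T).withDensity
                  (fun x => ENNReal.ofReal (Real.exp (φ x))) →
              K * δ ^ 2 ≤ ∫ x, (Real.exp (φ x) - Real.exp (φ (x.1, -x.2))) ^ 2 /
                  (Real.exp (φ x) + Real.exp (φ (x.1, -x.2)))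
                ∂(pinnedChain ω₂ lam β γ).gibbsMeasure N T

/-- ★ **ΔLower is a theorem.**  See the file docstring: duality
(`two_mul_integral_sub_le_integral_triangular` at `c = δ K/A`), the response hypothesis at the
test functions `G`, `G∘Θ`, `G²`, `(G∘Θ)²`, and density of test functions in `L²(μ_T)`
(`exists_smooth_integral_sub_sq_le`, polarisation). [folklore] -/
theorem nessFlipTriangularLower_holds : NessFlipTriangularLower := by
  intro ω₂ lam β γ hω₂ hlam hβ hγ hU μ hμ T hT N hN h hh K hK
  set P := pinnedChain ω₂ lam β γ with hP
  set μT := P.gibbsMeasure N T with hμT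
  haveI hprob : IsProbabilityMeasure μT :=
    pinnedChain_isProbabilityMeasure_gibbsMeasure hω₂ hlam.le hβ.le γ N hT
  have hinv : μT.map (fun x : PhaseSpace N => (x.1, -x.2)) = μT := gibbsMeasure_map_flip P N T
  -- `K ≤ 0`: nothing to prove
  rcases le_or_gt K 0 with hK0 | hK0
  · refine Eventually.of_forall fun δ φ hφm hrep => ?_
    exact (mul_nonpos_of_nonpos_of_nonneg hK0 (sq_nonneg δ)).trans
      (integral_nonneg fun x => triangular_nonneg _ _)
  have hG : μ N T T = μT := hU N T T hT hT _ _ (hμ N T T hT hT)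
    (pinnedChain_isSteadyState_gibbsMeasure hω₂ hlam.le hβ.le γ N hT)
  have hmp : MeasurePreserving (momentumReversal N) μT μT :=
    ⟨(momentumReversal N).measurable, gibbsMeasure_map_flip P N T⟩
  -- `k = h − h∘Θ ∈ L²(μ_T)`, `∫ k² > 2K`: a test function `G` and a slope `s`
  obtain ⟨hhL2, hresp, -⟩ := hh
  rw [hG] at hhL2 hK
  have hhΘL2 : MemLp (fun x => h (x.1, -x.2)) 2 μT := by
    have e : (fun x : PhaseSpace N => h (x.1, -x.2)) = h ∘ (momentumReversal N) := by funext x; simp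
    exact e ▸ hhL2.comp_measurePreserving hmp
  have hkL2 : MemLp (fun x => h x - h (x.1, -x.2)) 2 μT := hhL2.sub hhΘL2
  have hhi : Integrable h μT := hhL2.integrable one_le_two
  have hhΘi : Integrable (fun x => h (x.1, -x.2)) μT := hhΘL2.integrable one_le_two
  obtain ⟨G, s, M, hGs, hGc, hGcont, hM, hcoef⟩ :=
    exists_testFunction_coef_gt μT hkL2 hK0 (by linarith)
  set A : ℝ := ∫ x, G x * (h x - h (x.1, -x.2)) ∂μT with hA
  set B₀ : ℝ := ∫ x, G x ^ 2 ∂μT with hB₀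
  -- the response limits at the test functions `G`, `G∘Θ`, `G²`, `(G∘Θ)²`
  have hΘs : ContDiff ℝ ((⊤ : ℕ∞) : WithTop ℕ∞) (fun x : PhaseSpace N => (x.1, -x.2)) :=
    contDiff_fst.prodMk contDiff_snd.neg
  have hGΘs : ContDiff ℝ ((⊤ : ℕ∞) : WithTop ℕ∞) (fun x : PhaseSpace N => G (x.1, -x.2)) :=
    hGs.comp hΘs
  have hGΘc : HasCompactSupport (fun x : PhaseSpace N => G (x.1, -x.2)) :=
    hGc.comp_homeomorph ((Homeomorph.refl (Fin N → ℝ)).prodCongr (Homeomorph.neg (Fin N → ℝ)))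
  have hG2s : ContDiff ℝ ((⊤ : ℕ∞) : WithTop ℕ∞) (fun x => G x ^ 2) := hGs.pow 2
  have hG2c : HasCompactSupport (fun x => G x ^ 2) :=
    hGc.comp_left (g := fun t : ℝ => t ^ 2) (by simp)
  have hGΘ2s : ContDiff ℝ ((⊤ : ℕ∞) : WithTop ℕ∞) (fun x : PhaseSpace N => G (x.1, -x.2) ^ 2) :=
    hGΘs.pow 2
  have hGΘ2c : HasCompactSupport (fun x : PhaseSpace N => G (x.1, -x.2) ^ 2) :=
    hGΘc.comp_left (g := fun t : ℝ => t ^ 2) (by simp)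
  have t1 := hresp G hGs hGc
  have t2 := hresp _ hGΘs hGΘc
  have t3 := tendsto_of_tendsto_sub_div (hresp _ hG2s hG2c)
  have t4 := tendsto_of_tendsto_sub_div (hresp _ hGΘ2s hGΘ2c)
  rw [hG] at t1 t2 t3 t4
  -- the limit of the odd quotient is `A`
  have hcv : ∫ x, G (x.1, -x.2) * h x ∂μT = ∫ x, G x * h (x.1, -x.2) ∂μT := by
    have e := hmp.integral_comp' (fun y => G y * h (y.1, -y.2))
    simp only [momentumReversal_apply, neg_neg, Prod.mk.eta] at e
    exact e
  have hi1 : Integrable (fun x => G x * h x) μT :=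
    hhi.bdd_mul hGcont.aestronglyMeasurable (ae_of_all _ hM)
  have hi2 : Integrable (fun x => G x * h (x.1, -x.2)) μT :=
    hhΘi.bdd_mul hGcont.aestronglyMeasurable (ae_of_all _ hM)
  have hlimA : ∫ x, G x * h x ∂μT - ∫ x, G (x.1, -x.2) * h x ∂μT = A := by
    rw [hcv, ← integral_sub hi1 hi2, hA]
    refine integral_congr_ae (ae_of_all _ fun x => ?_)
    ring
  have ta := t1.sub t2
  rw [hlimA] at ta
  -- the limit of the even part is `2 B₀`
  have hB₀Θ : ∫ x, G (x.1, -x.2) ^ 2 ∂μT = B₀ := integral_comp_flip μT hinv (fun y => G y ^ 2)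
  have tb := t3.add t4
  rw [hB₀Θ, ← two_mul] at tb
  -- the coefficient converges to `2 s A − s² (2 B₀) > K`
  have tcoef := ((ta.const_mul (2 * s)).sub (tb.const_mul (s ^ 2)))
  have hev := tcoef.eventually (lt_mem_nhds hcoef)
  have hGΘT : ∫ x, G (x.1, -x.2) ∂μT = ∫ x, G x ∂μT := integral_comp_flip μT hinv G
  filter_upwards [hev, self_mem_nhdsWithin, eventually_bath_temps_pos hT] with δ hδ hne hδT φ hφm
    hrep
  have hne' : δ ≠ 0 := hne
  haveI : IsProbabilityMeasure (μ N (T + δ / 2) (T - δ / 2)) := (hμ N _ _ hδT.1 hδT.2).1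
  obtain ⟨hi, hz1, htilt⟩ := tilted_of_withDensity_exp hφm hrep
  have hdual := two_mul_integral_sub_le_integral_triangular μT hinv hφm hi hz1 hGcont hM (δ * s)
  rw [← htilt] at hdual
  -- `a_δ = δ · (odd quotient)`
  have ha : ∫ x, G x ∂(μ N (T + δ / 2) (T - δ / 2)) -
      ∫ x, G (x.1, -x.2) ∂(μ N (T + δ / 2) (T - δ / 2)) =
      δ * (((∫ x, G x ∂(μ N (T + δ / 2) (T - δ / 2))) - ∫ x, G x ∂μT) / δ -
        ((∫ x, G (x.1, -x.2) ∂(μ N (T + δ / 2) (T - δ / 2))) - ∫ x, G (x.1, -x.2) ∂μT) / δ) := by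
    rw [hGΘT]
    field_simp
    ring
  rw [ha] at hdual
  have h1 : K * δ ^ 2 ≤ (2 * s * (((∫ x, G x ∂(μ N (T + δ / 2) (T - δ / 2))) - ∫ x, G x ∂μT) / δ -
      ((∫ x, G (x.1, -x.2) ∂(μ N (T + δ / 2) (T - δ / 2))) - ∫ x, G (x.1, -x.2) ∂μT) / δ) -
      s ^ 2 * (∫ x, G x ^ 2 ∂(μ N (T + δ / 2) (T - δ / 2)) +
        ∫ x, G (x.1, -x.2) ^ 2 ∂(μ N (T + δ / 2) (T - δ / 2)))) * δ ^ 2 :=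
    mul_le_mul_of_nonneg_right hδ.le (sq_nonneg δ)
  nlinarith [h1, hdual]

end Summit.AtomisticToContinuum.FouriersLaw.Theorems.ExtensiveSnapshotIrreversibility.EnergyWindow

end
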